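import Literature.Probability.RandomPlanarGeometry.CurveSpace
import HarnessLib

/-!
# Reparametrising a simple curve to match another along a common initial arc

Topic `Probability/RandomPlanarGeometry`; elementary topology of curves, companion of
`Curve.lean` / `CurveSpace.lean` (the Aizenman–Burchard space of curves modulo increasing
reparametrisation). Everything here is PROVED; no named fact is introduced.

Let `c₁ c₂ : Curve E` be two injective (simple) curves in a metric space starting at the same
point, and suppose that their initial arcs `c₁[0, s₁]` and `c₂[0, s₂]` (`s₁, s₂ < 1`) coincide
AS SETS: `c₁ '' Iic s₁ = c₂ '' Iic s₂`. Then on that arc the two curves differ only by an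
increasing reparametrisation: the transition map `c₂⁻¹ ∘ c₁ : [0, s₁] → [0, s₂]` is a continuous
bijection between compact intervals (the inverse of the continuous injection `c₂` on the compact
set `[0, s₂]` is continuous on its image), hence strictly monotone, and increasing because it fixes
the common starting point; extending it affinely from `[s₁, 1]` onto `[s₂, 1]` gives an order
automorphism `θ` of `unitInterval` with `θ s₁ = s₂` and `c₁ = c₂ ∘ θ` on `[0, s₁]`
(`Curve.exists_reparam_eqOn_of_image_Iic_eq`). Consequently `c₂` has a representative
`c₂' = c₂.reparam θ` of the same curve class (`CurveClass.mk c₂' = CurveClass.mk c₂`, by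
`CurveClass.mk_reparam`) that agrees with `c₁` POINTWISE on `[0, s₁]`
(`Curve.exists_mk_eq_and_eqOn_of_image_Iic_eq`).

Consumer: the locality theorem for Loewner driving functions
`drivingFunction_eqOn_of_eqOn` (`LoewnerTransformLocality.lean`, the filtration argument of
Duminil-Copin–Smirnov, Clay lecture notes (2012), Prop. 6.7) asks for two curve REPRESENTATIVES
that agree pointwise on an initial parameter interval, whereas two boundary-attached self-avoiding
walk curves with a common walk prefix merely share an initial arc as a set (the attachment
prescribes the trace and injectivity, not the parametrisation); the present file bridges exactly
this gap.

## References

* M. Aizenman, A. Burchard, *Hölder regularity and dimension bounds for random curves*,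
  Duke Math. J. 99 (1999), §2.1 (curves modulo reparametrisation) [AizenmanBurchard1999].
-/

noncomputable section

open Set Function
open scoped unitInterval

namespace Literature.Probability.RandomPlanarGeometry

/-- The inverse of a continuous injection `f` from a compact space into a Hausdorff space,
restricted to a closed set `K`, is continuous on the image `f '' K`: preimages of closed sets are
traces of compact, hence closed, sets. [folklore] -/
private theorem continuousOn_invFunOn_image {X Y : Type*} [TopologicalSpace X] [CompactSpace X]
    [Nonempty X] [TopologicalSpace Y] [T2Space Y] {f : X → Y} (hf : Continuous f)
    (hinj : Injective f) {K : Set X} (hK : IsClosed K) :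
    ContinuousOn (invFunOn f K) (f '' K) := by
  rw [continuousOn_iff_isClosed]
  intro C hC
  refine ⟨f '' (C ∩ K), ((hC.inter hK).isCompact.image hf).isClosed, ?_⟩
  ext x
  constructor
  · rintro ⟨hxC, u, huK, rfl⟩
    have hex : ∃ a ∈ K, f a = f u := ⟨u, huK, rfl⟩
    exact ⟨⟨invFunOn f K (f u), ⟨hxC, invFunOn_mem hex⟩, invFunOn_eq hex⟩, u, huK, rfl⟩
  · rintro ⟨⟨y, ⟨hyC, hyK⟩, rfl⟩, hxA⟩
    refine ⟨?_, hxA⟩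
    show invFunOn f K (f y) ∈ C
    rwa [hinj.injOn.leftInvOn_invFunOn hyK]

/-- **Two simple curves with a common initial arc differ there by an increasing
reparametrisation.** If `c₁ c₂ : Curve E` are injective, start at the same point and have the same
initial arc as a set, `c₁ '' Iic s₁ = c₂ '' Iic s₂` with `s₁, s₂ < 1`, then there is an order
automorphism `θ` of `unitInterval` with `θ s₁ = s₂` and `c₁ t = c₂ (θ t)` for all `t ≤ s₁`
(the transition map `c₂⁻¹ ∘ c₁` on `[0, s₁]`, a continuous bijection onto `[0, s₂]` fixing `0`,
hence increasing, extended affinely from `[s₁, 1]` onto `[s₂, 1]`). [folklore] -/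
theorem Curve.exists_reparam_eqOn_of_image_Iic_eq {E : Type*} [MetricSpace E] {c₁ c₂ : Curve E}
    (h₁ : Function.Injective c₁) (h₂ : Function.Injective c₂) {s₁ s₂ : unitInterval}
    (hs₁ : s₁ < 1) (hs₂ : s₂ < 1) (h0 : c₁ 0 = c₂ 0)
    (himg : c₁ '' Set.Iic s₁ = c₂ '' Set.Iic s₂) :
    ∃ θ : unitInterval ≃o unitInterval, θ s₁ = s₂ ∧ Set.EqOn c₁ (c₂.reparam θ) (Set.Iic s₁) := by
  /- Step 1: the transition map `g = c₂⁻¹ ∘ c₁` on the initial arc `[0, s₁]`. -/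
  have hmem₁ : ∀ t ∈ Iic s₁, ∃ u ∈ Iic s₂, c₂ u = c₁ t := fun t ht => by
    have : c₁ t ∈ c₂ '' Iic s₂ := himg ▸ mem_image_of_mem _ ht
    exact this
  obtain ⟨g, hg_eq, hg_le, hg_cont⟩ : ∃ g : I → I, (∀ t ∈ Iic s₁, c₂ (g t) = c₁ t) ∧
      (∀ t ∈ Iic s₁, g t ≤ s₂) ∧ ContinuousOn g (Iic s₁) :=
    ⟨fun t => invFunOn c₂ (Iic s₂) (c₁ t), fun t ht => invFunOn_eq (hmem₁ t ht),
      fun t ht => invFunOn_mem (hmem₁ t ht),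
      (continuousOn_invFunOn_image c₂.continuous h₂ isClosed_Iic).comp
        c₁.continuous.continuousOn fun t ht => himg ▸ mem_image_of_mem _ ht⟩
  -- `g` maps `[0, s₁]` onto `[0, s₂]`
  have hg_surj : ∀ u ∈ Iic s₂, ∃ t ∈ Iic s₁, g t = u := by
    intro u hu
    obtain ⟨t, ht, hct⟩ : c₂ u ∈ c₁ '' Iic s₁ := himg ▸ mem_image_of_mem _ hu
    exact ⟨t, ht, h₂ (by rw [hg_eq t ht, hct])⟩
  have hg0 : g 0 = 0 := h₂ (by rw [hg_eq 0 unitInterval.nonneg', h0])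
  have hg_inj : InjOn g (Iic s₁) := fun t ht t' ht' h =>
    h₁ (by rw [← hg_eq t ht, ← hg_eq t' ht', h])
  -- a continuous injection of `[0, s₁]` fixing the bottom element is increasing
  have hg_mono : StrictMonoOn g (Iic s₁) := by
    rw [← Icc_bot]
    refine ContinuousOn.strictMonoOn_of_injOn_Icc bot_le ?_ (by rwa [Icc_bot]) (by rwa [Icc_bot])
    rw [show g ⊥ = 0 from hg0]
    exact bot_le
  have hgs₁ : g s₁ = s₂ := by
    refine le_antisymm (hg_le s₁ self_mem_Iic) ?_
    obtain ⟨t, ht, hts⟩ := hg_surj s₂ self_mem_Iic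
    exact hts ▸ hg_mono.monotoneOn ht self_mem_Iic ht
  /- Step 2: the increasing affine bijection `[s₁, 1] → [s₂, 1]` of slope
  `k = (1 - s₂) / (1 - s₁)`. -/
  have ha1 : (s₁ : ℝ) < 1 :=
    lt_of_le_of_ne (unitInterval.le_one s₁) (unitInterval.coe_ne_one.2 hs₁.ne)
  have hb1 : (s₂ : ℝ) < 1 :=
    lt_of_le_of_ne (unitInterval.le_one s₂) (unitInterval.coe_ne_one.2 hs₂.ne)
  obtain ⟨k, hk, hk1⟩ : ∃ k : ℝ, 0 < k ∧ (1 - (s₁ : ℝ)) * k = 1 - s₂ :=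
    ⟨(1 - s₂) / (1 - s₁), div_pos (sub_pos.2 hb1) (sub_pos.2 ha1), by
      rw [mul_div_assoc', mul_div_cancel_left₀ _ (sub_pos.2 ha1).ne']⟩
  have hk'1 : (1 - (s₂ : ℝ)) * k⁻¹ = 1 - s₁ := by
    rw [← hk1, mul_assoc, mul_inv_cancel₀ hk.ne', mul_one]
  have hLmem : ∀ t : I, s₁ < t → (s₂ : ℝ) + (t - s₁) * k ∈ Icc (0 : ℝ) 1 := by
    intro t ht
    have ht' : (s₁ : ℝ) < t := Subtype.coe_lt_coe.2 ht
    have hle : ((t : ℝ) - s₁) * k ≤ (1 - s₁) * k :=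
      mul_le_mul_of_nonneg_right (by linarith [unitInterval.le_one t]) hk.le
    refine ⟨?_, by linarith⟩
    exact (unitInterval.nonneg s₂).trans (le_add_of_nonneg_right (mul_nonneg (by linarith) hk.le))
  /- Step 3: glue, and upgrade the strictly monotone surjection to an order automorphism. -/
  obtain ⟨θ, hθ₁, hθ₂⟩ : ∃ θ : I → I, (∀ t, t ≤ s₁ → θ t = g t) ∧
      ∀ t, s₁ < t → (θ t : ℝ) = s₂ + (t - s₁) * k :=
    ⟨fun t => if h : t ≤ s₁ then g t else ⟨_, hLmem t (not_le.1 h)⟩, fun t ht => dif_pos ht,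
      fun t ht => by
        show ((if h : t ≤ s₁ then g t else ⟨(s₂ : ℝ) + (t - s₁) * k, hLmem t (not_le.1 h)⟩ : I) : ℝ)
          = _
        rw [dif_neg (not_le.2 ht)]⟩
  have hθ_mono : StrictMono θ := by
    intro t t' htt'
    rcases le_or_gt t' s₁ with ht' | ht'
    · rw [hθ₁ t (htt'.le.trans ht'), hθ₁ t' ht']
      exact hg_mono (htt'.le.trans ht') ht' htt'
    · rw [← Subtype.coe_lt_coe, hθ₂ t' ht']
      rcases le_or_gt t s₁ with ht | ht
      · rw [hθ₁ t ht]
        have h1 : ((g t : I) : ℝ) ≤ s₂ := Subtype.coe_le_coe.2 (hg_le t ht)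
        have h2 : (0 : ℝ) < (t' - s₁) * k := mul_pos (sub_pos.2 (Subtype.coe_lt_coe.2 ht')) hk
        linarith
      · rw [hθ₂ t ht]
        have h1 : ((t : ℝ) - s₁) * k < (t' - s₁) * k :=
          mul_lt_mul_of_pos_right (sub_lt_sub_right (Subtype.coe_lt_coe.2 htt') _) hk
        linarith
  have hθ_surj : Function.Surjective θ := by
    intro u
    rcases le_or_gt u s₂ with hu | hu
    · obtain ⟨t, ht, htu⟩ := hg_surj u hu
      exact ⟨t, by rw [hθ₁ t ht, htu]⟩
    · have hu' : (s₂ : ℝ) < u := Subtype.coe_lt_coe.2 hu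
      have hx₁ : (s₁ : ℝ) < s₁ + (u - s₂) * k⁻¹ :=
        lt_add_of_pos_right _ (mul_pos (sub_pos.2 hu') (inv_pos.2 hk))
      have hx₂ : (s₁ : ℝ) + (u - s₂) * k⁻¹ ≤ 1 := by
        have : ((u : ℝ) - s₂) * k⁻¹ ≤ (1 - s₂) * k⁻¹ :=
          mul_le_mul_of_nonneg_right (by linarith [unitInterval.le_one u]) (inv_pos.2 hk).le
        linarith
      obtain ⟨t, htx⟩ : ∃ t : I, (t : ℝ) = s₁ + (u - s₂) * k⁻¹ :=
        ⟨⟨_, (unitInterval.nonneg s₁).trans hx₁.le, hx₂⟩, rfl⟩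
      have hts : s₁ < t := Subtype.coe_lt_coe.1 (htx ▸ hx₁)
      refine ⟨t, Subtype.ext ?_⟩
      rw [hθ₂ t hts, htx]
      linear_combination ((u : ℝ) - s₂) * inv_mul_cancel₀ hk.ne'
  refine ⟨StrictMono.orderIsoOfSurjective θ hθ_mono hθ_surj, ?_, fun t ht => ?_⟩
  · rw [StrictMono.coe_orderIsoOfSurjective, hθ₁ s₁ le_rfl, hgs₁]
  · rw [Curve.reparam_apply, StrictMono.coe_orderIsoOfSurjective, hθ₁ t ht, hg_eq t ht]

/-- **A representative of the same curve class matching a given curve on a common initial arc.**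
If `c₁ c₂ : Curve E` are injective, start at the same point and have the same initial arc as a
set, `c₁ '' Iic s₁ = c₂ '' Iic s₂` with `s₁, s₂ < 1`, then some curve `c₂'` with
`CurveClass.mk c₂' = CurveClass.mk c₂` (Aizenman–Burchard space of curves modulo
reparametrisation) satisfies `c₂' s₁ = c₂ s₂` and agrees with `c₁` pointwise on `Iic s₁`; this is
the input format of the Loewner locality theorem `drivingFunction_eqOn_of_eqOn`. [folklore] -/
theorem Curve.exists_mk_eq_and_eqOn_of_image_Iic_eq {E : Type*} [MetricSpace E] {c₁ c₂ : Curve E}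
    (h₁ : Function.Injective c₁) (h₂ : Function.Injective c₂) {s₁ s₂ : unitInterval}
    (hs₁ : s₁ < 1) (hs₂ : s₂ < 1) (h0 : c₁ 0 = c₂ 0)
    (himg : c₁ '' Set.Iic s₁ = c₂ '' Set.Iic s₂) :
    ∃ c₂' : Curve E, CurveClass.mk c₂' = CurveClass.mk c₂ ∧ c₂' s₁ = c₂ s₂ ∧
      Set.EqOn c₁ c₂' (Set.Iic s₁) := by
  obtain ⟨θ, hθ, heq⟩ := Curve.exists_reparam_eqOn_of_image_Iic_eq h₁ h₂ hs₁ hs₂ h0 himg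
  exact ⟨c₂.reparam θ, CurveClass.mk_reparam c₂ θ, by rw [Curve.reparam_apply, hθ], heq⟩

end Literature.Probability.RandomPlanarGeometry

end
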